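import Literature.Probability.LatticeModels.LocalizedSwitching
import HarnessLib

/-!
# The localized switching for several independent pairs of currents (Aizenman–Duminil-Copin 2021, (6.14))

Topic `Literature/Probability/LatticeModels`. Theorems and auxiliary definitions only: **no named fact is
introduced** (D-0026).

The mixing property of random currents (M. Aizenman, H. Duminil-Copin, *Marginal triviality of the
scaling limits of critical 4D Ising and `φ⁴₄` models*, Ann. of Math. **194** (2021), arXiv:1912.07973,
**Theorem 6.4**; R. Panis, arXiv:2309.05797, Thm 6.20) is proved for `s` currents `n₁,…,n_s` (the first
`t` with sources `{x_i,y_i}`, the others sourceless) coupled to `s` independent auxiliary sourceless currents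
`n'₁,…,n'_s`, through the identity (6.14) (p. 24; Panis, display after Def. 6.22):

  "`P^{xy,∅}[(n₁,…,n_s) ∈ E ∩ F, u_i ↔ x_i in n_i+n'_i for i ≤ t, G(u₁,…,u_t)]`
  `= (∏ᵢ a_{x_i,y_i}(u_i)) · P^{xu,uy}[(n₁,…,n_s) ∈ E, (n'₁,…,n'_s) ∈ F, G(u₁,…,u_t)]`",

where `E` depends on the currents inside `Λ_n`, `F` on the currents outside `Λ_N`, and `G` is the
intersection over `i` of the split events `G_i` of the pairs `(n_i, n'_i)` ("for every `i ≤ s`, there exists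
`𝐤_i ≤ n_i + n'_i` such that `𝐤_i = 0` on `Λ_n`, `𝐤_i = n_i+n'_i` outside `Λ_N`, and `∂𝐤_i` is equal to
`{u_i,y_i}` if `i ≤ t` and `∅` if `t < i ≤ s`"). The source says "The switching principle implies as in
Section 4.2", i.e. the one-pair identity (4.10) — the tree's `Current.tsum_epairWeight_switch_local_conn`
(`LocalizedSwitching.lean`) — applied to each pair in turn. This file carries out that induction, in
un-normalised current-sum form, for any number `t` of pairs:

* configurations `ω : Fin t → Current G × Current G` (the pairs `(n_i, n'_i)`), product weights
  `Current.multiPairWeight K A B ω = ∏ᵢ 1{∂n_i = A_i}1{∂n'_i = B_i} w w`, the product of split indicators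
  `Current.multiSplitInd` and of connection indicators `Current.multiConnInd`;
* coordinatewise locality `Current.CoordLocal A E` of a functional `E : (Fin t → Current G) → ℝ≥0∞` of the
  `t` currents (in each current separately, the others being frozen, `E` depends only on the edges in `A`);
* **`Current.tsum_multiPair_switch_local`** — the identity
  `∑_ω (∏ᵢ 1{∂n_i={x_i}Δ{y_i}}1{∂n'_i=∅} w w) E(n) F(n) ∏ᵢ 𝟙[u_i ↔ x_i in n_i+n'_i] ∏ᵢ 𝟙[G_i]`
  `= ∑_ω (∏ᵢ 1{∂n_i={x_i}Δ{u_i}}1{∂n'_i={u_i}Δ{y_i}} w w) E(n) F(n') ∏ᵢ 𝟙[G_i]`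
  for `E` coordinatewise local on `E_in` and `F` on `E_out`. A sourceless pair `i` (printed `t < i ≤ s`) is
  the case `x_i = y_i = u_i` (`{u}Δ{u} = ∅`, split event with `∂𝐤_i = ∅`, connection indicator `≡ 1`).
  After division by the normalisations this is (6.14) with `a_{x,y}(u) = Z[xu]Z[uy]/(Z[xy]Z[∅])`.

## References

* M. Aizenman, H. Duminil-Copin, Ann. of Math. 194 (2021), arXiv:1912.07973, §6.2, (6.14) and the event
  `G(u₁,…,u_t)` (p. 24); §4.2, (4.10) (p. 13) [AizenmanDuminilCopinAnnals2021].
* R. Panis, arXiv:2309.05797 (2023), §6.4, Def. 6.22 and the display following it [Panis2023Triviality].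

## Mathlib

`Fin.consEquiv`, `Equiv.tsum_eq`, `ENNReal.tsum_prod`, `ENNReal.tsum_comm`, `ENNReal.tsum_mul_left`,
`Fin.prod_univ_succ`, `Fin.cons_update`, `Fin.update_cons_zero`, `DependsOn`.
-/

noncomputable section

open Finset Filter
open scoped symmDiff ENNReal

namespace Literature.Probability.LatticeModels

variable {V : Type*} [Fintype V] [DecidableEq V] {G : SimpleGraph V} [DecidableRel G.Adj]

namespace Current

/-! ### Product weights and indicators for `t` pairs of currents -/

/-- The un-normalised weight of `t` independent pairs of currents with prescribed sources,
`∏ᵢ 1{∂n_i = A_i} 1{∂n'_i = B_i} w(n_i) w(n'_i)` (the measures `P^{xy,∅}` and `P^{xu,uy}` of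
Aizenman–Duminil-Copin 2021, §6.2). [cite: AizenmanDuminilCopinAnnals2021, arXiv:1912.07973 §6.2, the measures P^{xy} ⊗ P^∅ and P^{xu,uy} (p. 23–24)] -/
def multiPairWeight {t : ℕ} (K : G.edgeFinset → ℝ) (A B : Fin t → Finset V)
    (ω : Fin t → Current G × Current G) : ℝ≥0∞ :=
  ∏ i, epairWeight K (A i) (B i) (ω i)

open Classical in
/-- The indicator of the event `G(u₁,…,u_t) = ⋂ᵢ G_i`: every pair `(n_i, n'_i)` satisfies its split event
`SplitEvent E_in E_out u_i y_i (n_i + n'_i)`. [cite: AizenmanDuminilCopinAnnals2021, arXiv:1912.07973 §6.2, the event G(u₁,…,u_t) (p. 24)] -/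
def multiSplitInd {t : ℕ} (Ein Eout : Finset G.edgeFinset) (u y : Fin t → V)
    (ω : Fin t → Current G × Current G) : ℝ≥0∞ :=
  ∏ i, if SplitEvent Ein Eout (u i) (y i) ((ω i).1 + (ω i).2) then 1 else 0

/-- The indicator of "`u_i ↔ x_i` in `n_i + n'_i` for every `i`". [cite: AizenmanDuminilCopinAnnals2021, arXiv:1912.07973 §6.2, (6.14) (p. 24)] -/
def multiConnInd {t : ℕ} (x u : Fin t → V) (ω : Fin t → Current G × Current G) : ℝ≥0∞ :=
  ∏ i, if u i ∈ ((ω i).1 + (ω i).2).cluster (x i) then 1 else 0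

/-- **Coordinatewise locality**: a functional of `t` currents depends on each current (the others being
frozen) only through its values on the edge set `A` ("events depending on the restriction of
`(n₁,…,n_s)` to edges within `Λ_n` [resp. outside `Λ_N`]"). [cite: AizenmanDuminilCopinAnnals2021, arXiv:1912.07973 Thm 6.4 (p. 21–22)] -/
def CoordLocal {t : ℕ} (A : Finset G.edgeFinset) (E : (Fin t → Current G) → ℝ≥0∞) : Prop :=
  ∀ (i : Fin t) (c : Fin t → Current G) (n n' : Current G), (∀ e ∈ A, n e = n' e) →
    E (Function.update c i n) = E (Function.update c i n')

omit [DecidableEq V] in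
/-- Freezing the first current of a coordinatewise-local functional gives a coordinatewise-local functional
of the remaining ones. [folklore] -/
theorem CoordLocal.cons {t : ℕ} {A : Finset G.edgeFinset} {E : (Fin (t + 1) → Current G) → ℝ≥0∞}
    (hE : CoordLocal A E) (a : Current G) : CoordLocal A (fun c : Fin t → Current G => E (Fin.cons a c)) := by
  intro i c n n' h
  simp only [Fin.cons_update]
  exact hE i.succ (Fin.cons a c) n n' h

omit [DecidableEq V] in
/-- As a function of the first current (the others frozen), a coordinatewise-local functional is local
(Mathlib's `DependsOn`). [folklore] -/
theorem CoordLocal.dependsOn_head {t : ℕ} {A : Finset G.edgeFinset} {E : (Fin (t + 1) → Current G) → ℝ≥0∞}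
    (hE : CoordLocal A E) (c : Fin t → Current G) :
    DependsOn (fun n : Current G => E (Fin.cons n c)) (↑A : Set G.edgeFinset) := by
  intro n n' h
  have h1 := hE 0 (Fin.cons n c) n n' (fun e he => h e he)
  simp only [Fin.update_cons_zero] at h1
  exact h1

/-! ### The identity -/

/-- **Aizenman–Duminil-Copin 2021, (6.14): the localized switching for `t` independent pairs, current-sum
form.** For couplings `K ≥ 0`, edge sets `E_in`, `E_out`, vertices `x_i, y_i, u_i` (`i < t`), and
functionals `E`, `F` of the `t` currents that are coordinatewise local on `E_in` resp. `E_out`: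
`∑_ω (∏ᵢ 1{∂n_i={x_i}Δ{y_i}}1{∂n'_i=∅} w w) · E(n) F(n) · ∏ᵢ 𝟙[u_i ↔ x_i in n_i+n'_i] · ∏ᵢ 𝟙[G_i(n_i+n'_i)]`
`= ∑_ω (∏ᵢ 1{∂n_i={x_i}Δ{u_i}}1{∂n'_i={u_i}Δ{y_i}} w w) · E(n) F(n') · ∏ᵢ 𝟙[G_i(n_i+n'_i)]`,
`G_i = SplitEvent E_in E_out u_i y_i`. Dividing by `∏ᵢ Z[x_iy_i]Z[∅]` resp. `∏ᵢ Z[x_iu_i]Z[u_iy_i]` gives the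
printed `P^{xy,∅}[(n) ∈ E ∩ F, u_i ↔ x_i ∀ i, G] = (∏ᵢ a_{x_i,y_i}(u_i)) P^{xu,uy}[(n) ∈ E, (n') ∈ F, G]`;
sourceless pairs are the case `x_i = y_i = u_i`. Proof: induction on `t`, the one-pair identity
`Current.tsum_epairWeight_switch_local_conn` applied to the first pair with the others frozen (Fubini in
`ℝ≥0∞`). [cite: AizenmanDuminilCopinAnnals2021, arXiv:1912.07973 §6.2, (6.14) (p. 24); §4.2, (4.10) (p. 13)] -/
theorem tsum_multiPair_switch_local {K : G.edgeFinset → ℝ} (hK : ∀ e, 0 ≤ K e)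
    (Ein Eout : Finset G.edgeFinset) :
    ∀ (t : ℕ) (x y u : Fin t → V) (E F : (Fin t → Current G) → ℝ≥0∞),
      CoordLocal Ein E → CoordLocal Eout F →
      ∑' ω : Fin t → Current G × Current G,
          multiPairWeight K (fun i => {x i} ∆ {y i}) (fun _ => ∅) ω *
            (E (fun i => (ω i).1) * F (fun i => (ω i).1) * multiConnInd x u ω * multiSplitInd Ein Eout u y ω) =
        ∑' ω : Fin t → Current G × Current G,
          multiPairWeight K (fun i => {x i} ∆ {u i}) (fun i => {u i} ∆ {y i}) ω *
            (E (fun i => (ω i).1) * F (fun i => (ω i).2) * multiSplitInd Ein Eout u y ω) := by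
  classical
  intro t
  induction t with
  | zero =>
    intro x y u E F _ _
    refine tsum_congr fun ω => ?_
    have h1 : (fun i => (ω i).1) = (fun i => (ω i).2) := funext fun i => Fin.elim0 i
    simp [multiPairWeight, multiConnInd, multiSplitInd, h1]
  | succ t ih =>
    intro x y u E F hE hF
    -- split off the first pair: `ω = Fin.cons p₀ rest`
    set e : (Current G × Current G) × (Fin t → Current G × Current G) ≃ (Fin (t + 1) → Current G × Current G) :=
      Fin.consEquiv fun _ => Current G × Current G with he
    conv_lhs => rw [← e.tsum_eq, ENNReal.tsum_prod']
    conv_rhs => rw [← e.tsum_eq, ENNReal.tsum_prod']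
    -- notation for the frozen data
    set x' : Fin t → V := fun i => x i.succ with hx'
    set y' : Fin t → V := fun i => y i.succ with hy'
    set u' : Fin t → V := fun i => u i.succ with hu'
    -- the factorisations along `Fin.cons`
    have hWold : ∀ (p₀ : Current G × Current G) (rest : Fin t → Current G × Current G),
        multiPairWeight K (fun i => {x i} ∆ {y i}) (fun _ => ∅) (e (p₀, rest)) =
          epairWeight K ({x 0} ∆ {y 0}) ∅ p₀ * multiPairWeight K (fun i => {x' i} ∆ {y' i}) (fun _ => ∅) rest := by
      intro p₀ rest
      simp only [multiPairWeight, he, Fin.consEquiv_apply, Fin.prod_univ_succ, Fin.cons_zero, Fin.cons_succ, hx', hy']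
    have hWnew : ∀ (p₀ : Current G × Current G) (rest : Fin t → Current G × Current G),
        multiPairWeight K (fun i => {x i} ∆ {u i}) (fun i => {u i} ∆ {y i}) (e (p₀, rest)) =
          epairWeight K ({x 0} ∆ {u 0}) ({u 0} ∆ {y 0}) p₀ *
            multiPairWeight K (fun i => {x' i} ∆ {u' i}) (fun i => {u' i} ∆ {y' i}) rest := by
      intro p₀ rest
      simp only [multiPairWeight, he, Fin.consEquiv_apply, Fin.prod_univ_succ, Fin.cons_zero, Fin.cons_succ, hx', hy', hu']
    have hS : ∀ (p₀ : Current G × Current G) (rest : Fin t → Current G × Current G),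
        multiSplitInd Ein Eout u y (e (p₀, rest)) =
          (if SplitEvent Ein Eout (u 0) (y 0) (p₀.1 + p₀.2) then 1 else 0) * multiSplitInd Ein Eout u' y' rest := by
      intro p₀ rest
      simp only [multiSplitInd, he, Fin.consEquiv_apply, Fin.prod_univ_succ, Fin.cons_zero, Fin.cons_succ, hu', hy']
    have hC : ∀ (p₀ : Current G × Current G) (rest : Fin t → Current G × Current G),
        multiConnInd x u (e (p₀, rest)) =
          (if u 0 ∈ (p₀.1 + p₀.2).cluster (x 0) then 1 else 0) * multiConnInd x' u' rest := by
      intro p₀ rest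
      simp only [multiConnInd, he, Fin.consEquiv_apply, Fin.prod_univ_succ, Fin.cons_zero, Fin.cons_succ, hx', hu']
    have hfst : ∀ (p₀ : Current G × Current G) (rest : Fin t → Current G × Current G),
        (fun i => (e (p₀, rest) i).1) = Fin.cons p₀.1 (fun i => (rest i).1) := by
      intro p₀ rest
      funext i
      refine Fin.cases ?_ (fun j => ?_) i
      · simp [he]
      · simp [he]
    have hsnd : ∀ (p₀ : Current G × Current G) (rest : Fin t → Current G × Current G),
        (fun i => (e (p₀, rest) i).2) = Fin.cons p₀.2 (fun i => (rest i).2) := by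
      intro p₀ rest
      funext i
      refine Fin.cases ?_ (fun j => ?_) i
      · simp [he]
      · simp [he]
    -- the constant (in the first pair) factor of the remaining pairs, old sources
    have cE_def : ∀ rest : Fin t → Current G × Current G, ∃ cE : ℝ≥0∞,
        cE = multiPairWeight K (fun i => {x' i} ∆ {y' i}) (fun _ => ∅) rest * multiConnInd x' u' rest *
          multiSplitInd Ein Eout u' y' rest := fun rest => ⟨_, rfl⟩
    -- Step 1 (pointwise in `rest`): switch the first pair, the others frozen
    have step1 : ∀ rest : Fin t → Current G × Current G,
        ∑' p₀ : Current G × Current G,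
          multiPairWeight K (fun i => {x i} ∆ {y i}) (fun _ => ∅) (e (p₀, rest)) *
            (E (fun i => (e (p₀, rest) i).1) * F (fun i => (e (p₀, rest) i).1) * multiConnInd x u (e (p₀, rest)) *
              multiSplitInd Ein Eout u y (e (p₀, rest))) =
        ∑' p₀ : Current G × Current G,
          (multiPairWeight K (fun i => {x' i} ∆ {y' i}) (fun _ => ∅) rest * multiConnInd x' u' rest *
            multiSplitInd Ein Eout u' y' rest) *
          (epairWeight K ({x 0} ∆ {u 0}) ({u 0} ∆ {y 0}) p₀ *
            (E (Fin.cons p₀.1 fun i => (rest i).1) * F (Fin.cons p₀.2 fun i => (rest i).1) *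
              (if SplitEvent Ein Eout (u 0) (y 0) (p₀.1 + p₀.2) then 1 else 0))) := by
      intro rest
      have hloc := tsum_epairWeight_switch_local_conn hK Ein Eout (x 0) (y 0) (u 0)
        (E := fun n => E (Fin.cons n fun i => (rest i).1)) (F := fun n => F (Fin.cons n fun i => (rest i).1))
        (hE.dependsOn_head _) (hF.dependsOn_head _)
      rw [ENNReal.tsum_mul_left, ← hloc, ← ENNReal.tsum_mul_left]
      refine tsum_congr fun p₀ => ?_
      rw [hWold, hS, hC, hfst]
      ring
    -- Step 2 (pointwise in `p₀`): the induction hypothesis for the remaining pairs, the first pair frozen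
    have step2 : ∀ p₀ : Current G × Current G,
        ∑' rest : Fin t → Current G × Current G,
          (multiPairWeight K (fun i => {x' i} ∆ {y' i}) (fun _ => ∅) rest * multiConnInd x' u' rest *
            multiSplitInd Ein Eout u' y' rest) *
          (epairWeight K ({x 0} ∆ {u 0}) ({u 0} ∆ {y 0}) p₀ *
            (E (Fin.cons p₀.1 fun i => (rest i).1) * F (Fin.cons p₀.2 fun i => (rest i).1) *
              (if SplitEvent Ein Eout (u 0) (y 0) (p₀.1 + p₀.2) then 1 else 0))) =
        ∑' rest : Fin t → Current G × Current G,
          multiPairWeight K (fun i => {x i} ∆ {u i}) (fun i => {u i} ∆ {y i}) (e (p₀, rest)) *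
            (E (fun i => (e (p₀, rest) i).1) * F (fun i => (e (p₀, rest) i).2) *
              multiSplitInd Ein Eout u y (e (p₀, rest))) := by
      intro p₀
      have hih := ih x' y' u' (fun c => E (Fin.cons p₀.1 c)) (fun c => F (Fin.cons p₀.2 c)) (hE.cons _) (hF.cons _)
      -- regroup the left side as `c₀ · (IH left summand)` and the right side as `c₀ · (IH right summand)`
      have hc₀ : ∃ c₀ : ℝ≥0∞, c₀ = epairWeight K ({x 0} ∆ {u 0}) ({u 0} ∆ {y 0}) p₀ *
          (if SplitEvent Ein Eout (u 0) (y 0) (p₀.1 + p₀.2) then 1 else 0) := ⟨_, rfl⟩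
      obtain ⟨c₀, hc₀⟩ := hc₀
      calc ∑' rest : Fin t → Current G × Current G,
            (multiPairWeight K (fun i => {x' i} ∆ {y' i}) (fun _ => ∅) rest * multiConnInd x' u' rest *
              multiSplitInd Ein Eout u' y' rest) *
            (epairWeight K ({x 0} ∆ {u 0}) ({u 0} ∆ {y 0}) p₀ *
              (E (Fin.cons p₀.1 fun i => (rest i).1) * F (Fin.cons p₀.2 fun i => (rest i).1) *
                (if SplitEvent Ein Eout (u 0) (y 0) (p₀.1 + p₀.2) then 1 else 0)))
          = ∑' rest : Fin t → Current G × Current G, c₀ *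
              (multiPairWeight K (fun i => {x' i} ∆ {y' i}) (fun _ => ∅) rest *
                (E (Fin.cons p₀.1 fun i => (rest i).1) * F (Fin.cons p₀.2 fun i => (rest i).1) *
                  multiConnInd x' u' rest * multiSplitInd Ein Eout u' y' rest)) := by
            refine tsum_congr fun rest => ?_
            rw [hc₀]; ring
        _ = c₀ * ∑' rest : Fin t → Current G × Current G,
              multiPairWeight K (fun i => {x' i} ∆ {u' i}) (fun i => {u' i} ∆ {y' i}) rest *
                (E (Fin.cons p₀.1 fun i => (rest i).1) * F (Fin.cons p₀.2 fun i => (rest i).2) *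
                  multiSplitInd Ein Eout u' y' rest) := by
            rw [ENNReal.tsum_mul_left, hih]
        _ = _ := by
            rw [← ENNReal.tsum_mul_left]
            refine tsum_congr fun rest => ?_
            rw [hWnew, hS, hfst, hsnd, hc₀]
            ring
    -- assemble: Fubini twice
    calc ∑' (p₀ : Current G × Current G) (rest : Fin t → Current G × Current G),
          multiPairWeight K (fun i => {x i} ∆ {y i}) (fun _ => ∅) (e (p₀, rest)) *
            (E (fun i => (e (p₀, rest) i).1) * F (fun i => (e (p₀, rest) i).1) * multiConnInd x u (e (p₀, rest)) *
              multiSplitInd Ein Eout u y (e (p₀, rest)))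
        = ∑' (rest : Fin t → Current G × Current G) (p₀ : Current G × Current G),
          multiPairWeight K (fun i => {x i} ∆ {y i}) (fun _ => ∅) (e (p₀, rest)) *
            (E (fun i => (e (p₀, rest) i).1) * F (fun i => (e (p₀, rest) i).1) * multiConnInd x u (e (p₀, rest)) *
              multiSplitInd Ein Eout u y (e (p₀, rest))) := ENNReal.tsum_comm
      _ = ∑' (rest : Fin t → Current G × Current G) (p₀ : Current G × Current G),
          (multiPairWeight K (fun i => {x' i} ∆ {y' i}) (fun _ => ∅) rest * multiConnInd x' u' rest *
            multiSplitInd Ein Eout u' y' rest) *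
          (epairWeight K ({x 0} ∆ {u 0}) ({u 0} ∆ {y 0}) p₀ *
            (E (Fin.cons p₀.1 fun i => (rest i).1) * F (Fin.cons p₀.2 fun i => (rest i).1) *
              (if SplitEvent Ein Eout (u 0) (y 0) (p₀.1 + p₀.2) then 1 else 0))) := tsum_congr step1
      _ = ∑' (p₀ : Current G × Current G) (rest : Fin t → Current G × Current G),
          (multiPairWeight K (fun i => {x' i} ∆ {y' i}) (fun _ => ∅) rest * multiConnInd x' u' rest *
            multiSplitInd Ein Eout u' y' rest) *
          (epairWeight K ({x 0} ∆ {u 0}) ({u 0} ∆ {y 0}) p₀ *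
            (E (Fin.cons p₀.1 fun i => (rest i).1) * F (Fin.cons p₀.2 fun i => (rest i).1) *
              (if SplitEvent Ein Eout (u 0) (y 0) (p₀.1 + p₀.2) then 1 else 0))) := ENNReal.tsum_comm
      _ = _ := tsum_congr step2

end Current

end Literature.Probability.LatticeModels
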